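/-
Copyright (c) 2026 the pub-hodgecm-mathlib formalisation cell (harness21).  Prover seat hodgecm-mathlib-LH10-p01 (g10): road M6 «ROW 2 ★ DYADIC TWIN» (LEAD F0P3a-plan T14-66),
dealer LH4-plan (g8) WORD #68 DEAL g8-#18 (O-5) «BLOCK-DIAGONAL FRAME φ_w AS AN ALGHOM» for F0P3a-p04 (g30)'s F5 binder map; 2026-09-02.
-/
import Literature.NumberTheory.Rogawski1990.UnitFundamentalLemmaInertIrredClauseOfValuesStubFrame   -- ★ `mul_eq_mul_reindex_fromBlocks_of_conj_endoEmbLocal_eq` (the block frame of a match); brings ★ `EndoscopicEmbedding.endoPerm`, `endoEmbLocal`, `finGammaTwo`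
import HarnessLib

/-!
# The block-diagonal frame `(g, u) ↦ c · [g 0; 0 u] · c⁻¹` as a unital `K`-algebra map `M₂(K) × K →ₐ[K] M₃(K)` — the `φ` of ★ (W1) ∕ TOT-Λ

Topic `NumberTheory/Rogawski1990`; namespace `Literature.NumberTheory.Rogawski1990`.  THEOREMS ONLY (no definition, no instance, no notation, no named fact, no `sorry`; the
`AlgHom` is built INSIDE the proof term); kernel lane `--supports stmt-HodgeConjecture-24833`.  Cell `pub/hodgecm-mathlib` (D-0151), crux H413; road M6 «ROW 2 ★ DYADIC TWIN»
(LEAD F0P3a-plan (g15) T14-66), dealer LH4-plan (g8) WORD #68 DEAL g8-#18 = F0P3a-p04 (g30)'s F5 OPEN item (O-5) «`φ_w` glue»: ★ (W1)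
`SelfDualLatticeFixOrderOnly.ncard_vertex_rowZero_eq_of_total` (:206) and ★ `smul_map_sub_one_eq_map_shift` (:152) take the endoscopic frame as an ABSTRACT unital
`K`-algebra map `φ : (Matrix (Fin 2) (Fin 2) K × K) →ₐ[K] Matrix (Fin N) (Fin N) K`; the F5 head holds a CONCRETE frame `c ∈ GL₃` conjugating the block embedding
`ι(γ_H) = e·[g 0; 0 u]·e` (`e = endoPerm : Fin 2 ⊕ Fin 1 ≃ Fin 3`, ★ `EndoscopicEmbedding` :95) onto the match `b` (★ `mul_eq_mul_reindex_fromBlocks_of_conj_endoEmbLocal_eq`).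
THIS FILE supplies the glue: (§1) block-diagonal algebra (`fromBlocks g 0 0 h` is multiplicative, additive, unital, `K`-linear); (§2) for ANY commutative ring `K` and any
`c ∈ GL₃(K)` there IS a unital `K`-algebra map `φ` with `φ (g, u) = c · reindex e e [g 0; 0 u•1] · c⁻¹` for all `(g, u)` (`exists_algHom_blockFrame`) — exactly ★ (W1)'s argument
type when `K` is a field; (§3) docking: from `c · ι_v(γ_H) · c⁻¹ = b` (the tree's `IsLocalNormPair`-style conjugacy over the semilocal ring `LocalRing L v`), `φ (γ_H.1, u) = b`
(`exists_algHom_blockFrame_apply_eq_of_conj`), and the same AT THE PLACE `w` after `Pi.evalRingHom … w` (`exists_algHom_blockFrame_apply_eq_of_conj_place`) — the frame in which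
★ (W1), F2 ★ p852809 and the R2² rows read the match.  No valuation, no `2`, no hermitian structure: pure matrix algebra.
HONEST LABEL: HC_CM is proved only modulo the 7 printed citations (2 remaining named inputs: hLiu418 = stmt-HodgeConjecture-24832, h413 = stmt-HodgeConjecture-24833) until rung 0 closes;
elementary algebra, count-neutral (zero label movement until F5 ★ + a desk-priced rider).

* §1 `fromBlocks_diag_mul_fromBlocks_diag`, `fromBlocks_diag_add_fromBlocks_diag`, `smul_fromBlocks_diag`, `fromBlocks_smul_one_eq_of_fin_one`, `map_reindex_fromBlocks_diag`, `map_of_fin_one`.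
* §2 **`exists_algHom_blockFrame`**.
* §3 `exists_algHom_blockFrame_apply_eq_of_conj`, `exists_algHom_blockFrame_apply_eq_of_conj_place`.

## References
* [Rogawski1990] J. D. Rogawski, *Automorphic Representations of Unitary Groups in Three Variables* (1990): §4.8 Case (a) p. 53 (the endoscopic embedding
  `H = U(2) × U(1) ⊂ U(3)`); §4.9 p. 55.
* [HornJohnson2013] R. A. Horn, C. R. Johnson, *Matrix Analysis* (2nd ed. 2013): §0.7.1–§0.7.2 (partitioned matrices, block-diagonal products).
-/

set_option autoImplicit false

open Matrix
open scoped MatrixGroups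

namespace Literature.NumberTheory.Rogawski1990

/-! ## §1 Block-diagonal algebra -/

section BlockAlgebra

/-- `[g₁ 0; 0 h₁] · [g₂ 0; 0 h₂] = [g₁g₂ 0; 0 h₁h₂]`. [cite: HornJohnson2013, §0.7.2] -/
theorem fromBlocks_diag_mul_fromBlocks_diag {K : Type*} [CommRing K] {m n : Type*} [Fintype m] [Fintype n]
    (g₁ g₂ : Matrix m m K) (h₁ h₂ : Matrix n n K) :
    Matrix.fromBlocks g₁ 0 0 h₁ * Matrix.fromBlocks g₂ 0 0 h₂ = Matrix.fromBlocks (g₁ * g₂) 0 0 (h₁ * h₂) := by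
  rw [Matrix.fromBlocks_multiply]
  simp

/-- `[g₁ 0; 0 h₁] + [g₂ 0; 0 h₂] = [g₁+g₂ 0; 0 h₁+h₂]`. [cite: HornJohnson2013, §0.7.1] -/
theorem fromBlocks_diag_add_fromBlocks_diag {K : Type*} [CommRing K] {m n : Type*} (g₁ g₂ : Matrix m m K) (h₁ h₂ : Matrix n n K) :
    Matrix.fromBlocks g₁ 0 0 h₁ + Matrix.fromBlocks g₂ 0 0 h₂ = Matrix.fromBlocks (g₁ + g₂) 0 0 (h₁ + h₂) := by
  rw [Matrix.fromBlocks_add, add_zero, add_zero]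

/-- `r • [g 0; 0 h] = [r•g 0; 0 r•h]`. [cite: HornJohnson2013, §0.7.1] -/
theorem smul_fromBlocks_diag {K : Type*} [CommRing K] {m n : Type*} (r : K) (g : Matrix m m K) (h : Matrix n n K) :
    r • Matrix.fromBlocks g 0 0 h = Matrix.fromBlocks (r • g) 0 0 (r • h) := by
  rw [Matrix.fromBlocks_smul, smul_zero, smul_zero]

/-- A `1 × 1` matrix is the scalar matrix of its entry: `!![u] = u • 1`. [cite: HornJohnson2013, §0.7.1] -/
theorem fromBlocks_smul_one_eq_of_fin_one {K : Type*} [CommRing K] (u : K) : (!![u] : Matrix (Fin 1) (Fin 1) K) = u • (1 : Matrix (Fin 1) (Fin 1) K) := by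
  ext i j
  fin_cases i; fin_cases j
  simp

/-- Entrywise maps commute with the block-diagonal reindexing: `(reindex e e [g 0; 0 h]).map f = reindex e e [g.map f 0; 0 h.map f]` for a ring map `f`.
[cite: HornJohnson2013, §0.7.1] -/
theorem map_reindex_fromBlocks_diag {R S : Type*} [CommRing R] [CommRing S] (f : R →+* S) {m n o : Type*} (e : m ⊕ n ≃ o)
    (g : Matrix m m R) (h : Matrix n n R) :
    (Matrix.reindex e e (Matrix.fromBlocks g 0 0 h)).map f = Matrix.reindex e e (Matrix.fromBlocks (g.map f) 0 0 (h.map f)) := by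
  rw [Matrix.reindex_apply, Matrix.reindex_apply, ← Matrix.submatrix_map, Matrix.fromBlocks_map,
    Matrix.map_zero _ (map_zero f), Matrix.map_zero _ (map_zero f)]

/-- `!![x].map f = !![f x]`. [cite: HornJohnson2013, §0.7.1] -/
theorem map_of_fin_one {R S : Type*} (f : R → S) (x : R) : (!![x] : Matrix (Fin 1) (Fin 1) R).map f = !![f x] := by
  ext i j
  fin_cases i; fin_cases j
  rfl

end BlockAlgebra

/-! ## §2 The frame as a unital `K`-algebra map -/

section Frame

variable {K : Type*} [CommRing K]

/-- **THE BLOCK-DIAGONAL FRAME IS A UNITAL `K`-ALGEBRA MAP.**  For any commutative ring `K` and any `c ∈ GL₃(K)` there is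
`φ : (Matrix (Fin 2) (Fin 2) K × K) →ₐ[K] Matrix (Fin 3) (Fin 3) K` with `φ (g, u) = c · reindex e e [g 0; 0 u•1] · c⁻¹` for all `g, u` (`e = endoPerm`): block-diagonal
embedding is multiplicative∕additive∕unital∕`K`-linear (§1), `reindex e e` is a `K`-algebra equivalence (`Matrix.reindexAlgEquiv`), and conjugation by a unit is a `K`-algebra
automorphism.  This is the `φ` argument type of ★ (W1) `SelfDualLatticeFixOrderOnly.ncard_vertex_rowZero_eq_of_total` and ★ `smul_map_sub_one_eq_map_shift`.
[cite: Rogawski1990, §4.8 Case (a) p. 53] [cite: HornJohnson2013, §0.7.2] -/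
theorem exists_algHom_blockFrame (c : GL (Fin 3) K) :
    ∃ φ : (Matrix (Fin 2) (Fin 2) K × K) →ₐ[K] Matrix (Fin 3) (Fin 3) K,
      ∀ (g : Matrix (Fin 2) (Fin 2) K) (u : K),
        φ (g, u) = (c : Matrix (Fin 3) (Fin 3) K) * Matrix.reindex endoPerm endoPerm (Matrix.fromBlocks g 0 0 (u • (1 : Matrix (Fin 1) (Fin 1) K))) *
          ((c⁻¹ : GL (Fin 3) K) : Matrix (Fin 3) (Fin 3) K) := by
  -- the block-diagonal embedding `M₂(K) × K → M_{2+1}(K)` as a unital `K`-algebra map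
  let β : (Matrix (Fin 2) (Fin 2) K × K) →ₐ[K] Matrix (Fin 2 ⊕ Fin 1) (Fin 2 ⊕ Fin 1) K :=
    { toFun := fun p => Matrix.fromBlocks p.1 0 0 (p.2 • (1 : Matrix (Fin 1) (Fin 1) K))
      map_one' := by
        show Matrix.fromBlocks (1 : Matrix (Fin 2) (Fin 2) K) 0 0 ((1 : K) • (1 : Matrix (Fin 1) (Fin 1) K)) = 1
        rw [one_smul, Matrix.fromBlocks_one]
      map_mul' := fun p q => by
        show Matrix.fromBlocks (p.1 * q.1) 0 0 ((p.2 * q.2) • (1 : Matrix (Fin 1) (Fin 1) K)) =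
          Matrix.fromBlocks p.1 0 0 (p.2 • (1 : Matrix (Fin 1) (Fin 1) K)) * Matrix.fromBlocks q.1 0 0 (q.2 • (1 : Matrix (Fin 1) (Fin 1) K))
        rw [fromBlocks_diag_mul_fromBlocks_diag, smul_mul_smul_comm, one_mul, mul_smul]
      map_zero' := by
        show Matrix.fromBlocks (0 : Matrix (Fin 2) (Fin 2) K) 0 0 ((0 : K) • (1 : Matrix (Fin 1) (Fin 1) K)) = 0
        rw [zero_smul, Matrix.fromBlocks_zero]
      map_add' := fun p q => by
        show Matrix.fromBlocks (p.1 + q.1) 0 0 ((p.2 + q.2) • (1 : Matrix (Fin 1) (Fin 1) K)) =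
          Matrix.fromBlocks p.1 0 0 (p.2 • (1 : Matrix (Fin 1) (Fin 1) K)) + Matrix.fromBlocks q.1 0 0 (q.2 • (1 : Matrix (Fin 1) (Fin 1) K))
        rw [fromBlocks_diag_add_fromBlocks_diag, add_smul]
      commutes' := fun r => by
        show Matrix.fromBlocks ((algebraMap K (Matrix (Fin 2) (Fin 2) K × K) r).1) 0 0
            ((algebraMap K (Matrix (Fin 2) (Fin 2) K × K) r).2 • (1 : Matrix (Fin 1) (Fin 1) K)) =
          algebraMap K (Matrix (Fin 2 ⊕ Fin 1) (Fin 2 ⊕ Fin 1) K) r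
        rw [Prod.algebraMap_apply, Algebra.algebraMap_eq_smul_one, Algebra.algebraMap_eq_smul_one, Algebra.algebraMap_eq_smul_one, smul_eq_mul, mul_one,
          ← smul_fromBlocks_diag, Matrix.fromBlocks_one] }
  have hβ : ∀ (g : Matrix (Fin 2) (Fin 2) K) (u : K), β (g, u) = Matrix.fromBlocks g 0 0 (u • (1 : Matrix (Fin 1) (Fin 1) K)) := fun _ _ => rfl
  -- conjugation by the unit `c` as a unital `K`-algebra map
  let κ : Matrix (Fin 3) (Fin 3) K →ₐ[K] Matrix (Fin 3) (Fin 3) K :=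
    { toFun := fun x => (c : Matrix (Fin 3) (Fin 3) K) * x * ((c⁻¹ : GL (Fin 3) K) : Matrix (Fin 3) (Fin 3) K)
      map_one' := by
        show (c : Matrix (Fin 3) (Fin 3) K) * 1 * ((c⁻¹ : GL (Fin 3) K) : Matrix (Fin 3) (Fin 3) K) = 1
        rw [mul_one, ← Units.val_mul, mul_inv_cancel, Units.val_one]
      map_mul' := fun x y => by
        show (c : Matrix (Fin 3) (Fin 3) K) * (x * y) * ((c⁻¹ : GL (Fin 3) K) : Matrix (Fin 3) (Fin 3) K) =
          (c : Matrix (Fin 3) (Fin 3) K) * x * ((c⁻¹ : GL (Fin 3) K) : Matrix (Fin 3) (Fin 3) K) *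
            ((c : Matrix (Fin 3) (Fin 3) K) * y * ((c⁻¹ : GL (Fin 3) K) : Matrix (Fin 3) (Fin 3) K))
        have h : ((c⁻¹ : GL (Fin 3) K) : Matrix (Fin 3) (Fin 3) K) * (c : Matrix (Fin 3) (Fin 3) K) = 1 := by
          rw [← Units.val_mul, inv_mul_cancel, Units.val_one]
        calc (c : Matrix (Fin 3) (Fin 3) K) * (x * y) * ((c⁻¹ : GL (Fin 3) K) : Matrix (Fin 3) (Fin 3) K)
            = (c : Matrix (Fin 3) (Fin 3) K) * x * (((c⁻¹ : GL (Fin 3) K) : Matrix (Fin 3) (Fin 3) K) * (c : Matrix (Fin 3) (Fin 3) K)) * y *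
                ((c⁻¹ : GL (Fin 3) K) : Matrix (Fin 3) (Fin 3) K) := by rw [h]; simp only [Matrix.mul_assoc, Matrix.one_mul]
          _ = _ := by simp only [Matrix.mul_assoc]
      map_zero' := by
        show (c : Matrix (Fin 3) (Fin 3) K) * 0 * ((c⁻¹ : GL (Fin 3) K) : Matrix (Fin 3) (Fin 3) K) = 0
        rw [mul_zero, zero_mul]
      map_add' := fun x y => by
        show (c : Matrix (Fin 3) (Fin 3) K) * (x + y) * ((c⁻¹ : GL (Fin 3) K) : Matrix (Fin 3) (Fin 3) K) =
          (c : Matrix (Fin 3) (Fin 3) K) * x * ((c⁻¹ : GL (Fin 3) K) : Matrix (Fin 3) (Fin 3) K) +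
            (c : Matrix (Fin 3) (Fin 3) K) * y * ((c⁻¹ : GL (Fin 3) K) : Matrix (Fin 3) (Fin 3) K)
        rw [mul_add, add_mul]
      commutes' := fun r => by
        show (c : Matrix (Fin 3) (Fin 3) K) * algebraMap K (Matrix (Fin 3) (Fin 3) K) r * ((c⁻¹ : GL (Fin 3) K) : Matrix (Fin 3) (Fin 3) K) =
          algebraMap K (Matrix (Fin 3) (Fin 3) K) r
        rw [Algebra.algebraMap_eq_smul_one, Matrix.mul_smul, mul_one, Matrix.smul_mul, ← Units.val_mul, mul_inv_cancel, Units.val_one] }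
  have hκ : ∀ x, κ x = (c : Matrix (Fin 3) (Fin 3) K) * x * ((c⁻¹ : GL (Fin 3) K) : Matrix (Fin 3) (Fin 3) K) := fun _ => rfl
  refine ⟨κ.comp (((Matrix.reindexAlgEquiv K K endoPerm).toAlgHom).comp β), fun g u => ?_⟩
  rw [AlgHom.comp_apply, AlgHom.comp_apply, hβ, hκ]
  rfl

end Frame

/-! ## §3 Docking with the tree's conjugacy `c · ι_v(γ_H) · c⁻¹ = b` -/

section Docking

open NumberField IsDedekindDomain
open Literature.NumberTheory.Automorphic Literature.NumberTheory.Automorphic.UnitaryGroup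

variable (L : Type) [Field L] [NumberField L] [IsCMField L] (H' : Matrix (Fin 3) (Fin 3) L) {v : HeightOneSpectrum (𝓞 ↥(maximalRealSubfield L))}

/-- **DOCKING OVER THE SEMILOCAL RING `L_v = ∏_{w ∣ v} L_w`.**  If `c · ι_v(γ_H) · c⁻¹ = b` in `GL₃(L_v)` (the frame of a match read off the embedding, ★
`mul_eq_mul_reindex_fromBlocks_of_conj_endoEmbLocal_eq`), then the unital `L_v`-algebra map `φ` of §2 at `c` satisfies `φ (g, u) = b` for `g` the matrix of `γ_H.1` and
`u = finGammaTwo γ_H` (the `U(1)`-block read as a scalar). [cite: Rogawski1990, §4.8 Case (a) p. 53] -/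
theorem exists_algHom_blockFrame_apply_eq_of_conj
    (γH : (cmDatum L 2 (Matrix.of fun i j : Fin 2 => if i.val + j.val + 1 = 2 then (1 : L) else 0)).Local v ×
      (cmDatum L 1 (Matrix.of fun i j : Fin 1 => if i.val + j.val + 1 = 1 then (1 : L) else 0)).Local v)
    {b : (cmDatum L 3 H').Local v} {c : GL (Fin 3) (LocalRing L v)}
    (hc : c * ((endoEmbLocal L v γH).val : GL (Fin 3) (LocalRing L v)) * c⁻¹ = (b.val : GL (Fin 3) (LocalRing L v))) :
    ∃ φ : (Matrix (Fin 2) (Fin 2) (LocalRing L v) × LocalRing L v) →ₐ[LocalRing L v] Matrix (Fin 3) (Fin 3) (LocalRing L v),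
      (∀ (g : Matrix (Fin 2) (Fin 2) (LocalRing L v)) (u : LocalRing L v),
        φ (g, u) = c.val * Matrix.reindex endoPerm endoPerm (Matrix.fromBlocks g 0 0 (u • (1 : Matrix (Fin 1) (Fin 1) (LocalRing L v)))) * (c⁻¹).val) ∧
      φ (((γH.1.val : GL (Fin 2) (LocalRing L v)).val), finGammaTwo L v γH) = (b.val.val : Matrix (Fin 3) (Fin 3) (LocalRing L v)) := by
  obtain ⟨φ, hφ⟩ := exists_algHom_blockFrame (K := LocalRing L v) c
  refine ⟨φ, hφ, ?_⟩
  have hframe := mul_eq_mul_reindex_fromBlocks_of_conj_endoEmbLocal_eq L H' γH hc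
  have hcc : c.val * (c⁻¹).val = (1 : Matrix (Fin 3) (Fin 3) (LocalRing L v)) := by
    rw [← Units.val_mul, mul_inv_cancel, Units.val_one]
  rw [hφ, ← fromBlocks_smul_one_eq_of_fin_one, ← hframe, Matrix.mul_assoc, hcc, Matrix.mul_one]

/-- **DOCKING AT THE PLACE `w`.**  The same after evaluation at a place `w ∣ v` (`Pi.evalRingHom … w`, the frame in which ★ (W1), ★ F2 `exists_eisensteinData` and the R2²
rows read the match): with `c_w = c.map ev`, `g_w`, `u_w = finGammaTwo γ_H w`, `b_w` the `w`-components, the unital `L_w`-algebra map `φ_w` of §2 at `c_w` has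
`φ_w (g_w, u_w) = b_w`. [cite: Rogawski1990, §4.8 Case (a) p. 53] -/
theorem exists_algHom_blockFrame_apply_eq_of_conj_place (w : PlacesOver L v)
    (γH : (cmDatum L 2 (Matrix.of fun i j : Fin 2 => if i.val + j.val + 1 = 2 then (1 : L) else 0)).Local v ×
      (cmDatum L 1 (Matrix.of fun i j : Fin 1 => if i.val + j.val + 1 = 1 then (1 : L) else 0)).Local v)
    {b : (cmDatum L 3 H').Local v} {c : GL (Fin 3) (LocalRing L v)}
    (hc : c * ((endoEmbLocal L v γH).val : GL (Fin 3) (LocalRing L v)) * c⁻¹ = (b.val : GL (Fin 3) (LocalRing L v))) :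
    ∃ φ : (Matrix (Fin 2) (Fin 2) (w.1.adicCompletion L) × w.1.adicCompletion L) →ₐ[w.1.adicCompletion L] Matrix (Fin 3) (Fin 3) (w.1.adicCompletion L),
      (∀ (g : Matrix (Fin 2) (Fin 2) (w.1.adicCompletion L)) (u : w.1.adicCompletion L),
        φ (g, u) = (Units.map (RingHom.mapMatrix (Pi.evalRingHom (fun w' : PlacesOver L v => w'.1.adicCompletion L) w)).toMonoidHom c).val *
          Matrix.reindex endoPerm endoPerm (Matrix.fromBlocks g 0 0 (u • (1 : Matrix (Fin 1) (Fin 1) (w.1.adicCompletion L)))) *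
            ((Units.map (RingHom.mapMatrix (Pi.evalRingHom (fun w' : PlacesOver L v => w'.1.adicCompletion L) w)).toMonoidHom c)⁻¹).val) ∧
      φ ((((γH.1.val : GL (Fin 2) (LocalRing L v)).val).map (Pi.evalRingHom (fun w' : PlacesOver L v => w'.1.adicCompletion L) w)), finGammaTwo L v γH w) =
        ((b.val.val : Matrix (Fin 3) (Fin 3) (LocalRing L v))).map (Pi.evalRingHom (fun w' : PlacesOver L v => w'.1.adicCompletion L) w) := by
  set ev := Pi.evalRingHom (fun w' : PlacesOver L v => w'.1.adicCompletion L) w with hev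
  set cw : GL (Fin 3) (w.1.adicCompletion L) := Units.map (RingHom.mapMatrix ev).toMonoidHom c with hcw
  obtain ⟨φ, hφ⟩ := exists_algHom_blockFrame (K := w.1.adicCompletion L) cw
  refine ⟨φ, hφ, ?_⟩
  -- push the semilocal frame identity `b·c = c·[g 0; 0 u]` to the place `w`
  have hframe_w := congrArg (fun M : Matrix (Fin 3) (Fin 3) (LocalRing L v) => M.map ev) (mul_eq_mul_reindex_fromBlocks_of_conj_endoEmbLocal_eq L H' γH hc)
  simp only [Matrix.map_mul] at hframe_w
  rw [map_reindex_fromBlocks_diag, map_of_fin_one] at hframe_w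
  have hcwval : cw.val = (c.val : Matrix (Fin 3) (Fin 3) (LocalRing L v)).map ev := rfl
  have hcc : cw.val * (cw⁻¹).val = (1 : Matrix (Fin 3) (Fin 3) (w.1.adicCompletion L)) := by
    rw [← Units.val_mul, mul_inv_cancel, Units.val_one]
  have hu : ev (finGammaTwo L v γH) = finGammaTwo L v γH w := rfl
  rw [hφ, ← fromBlocks_smul_one_eq_of_fin_one, ← hu, hcwval, ← hframe_w, ← hcwval, Matrix.mul_assoc, hcc, Matrix.mul_one]

end Docking

end Literature.NumberTheory.Rogawski1990
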